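import Summits.ResolutionOfSingularities.ResolutionOfSingularities.Theorems.HilbertSamuelEliminationSigmaMaxModificationsCorridor3Directrix214SharpDischarged
import Literature.AlgebraicGeometry.Resolution.HironakaGroupSchemeCharZero
import Literature.RingTheory.HilbertSamuel.HironakaGrothendieckIsomorphism
import Literature.AlgebraicGeometry.Resolution.NormalCrossingsStrictification
import HarnessLib

/-!
# [OURS · L1 W4.2] CJS Thm. 3.14 (numerical form) FROM [H4] THEOREM IV ALONE:
# `cjs_thm_3_14_of_thmIV : Hironaka1970_thmIV → CossartJannsenSaito2020_thm_3_14`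

Cell res-hironaka, rung L, slot W4.2 (crux `SigmaMaxModificationsCorridor3`, stmt-ResolutionOfSingularities-19249),
helper class. After T7b (`theorem314_geomDir_of_facts`, res-type-001) the two directrix binders of the characteristic-2
row rested on the printed facts F-51′ `Hironaka1970_thmIV` ([H4] Th. IV), F-split `HerrmannIkedaOrbanz1988_cor_21_11`
(DISCHARGED: `HerrmannIkedaOrbanz1988_cor_21_11_holds`, res-D-lib-1 p518484) and — for the branch `char k(x) = 0` only —
CJS Thm. 3.14 as printed (`CossartJannsenSaito2020_thm_3_14`, p499700; 42 binder uses in the W4.2 files). This file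
removes the last one: **CJS Thm. 3.14 follows from [H4] Th. IV in EVERY characteristic**, exactly as CJS prove it
(p. 52: «[H4, Theorem IV], [H5, Theorem 2], and [Miz] … a vector subspace of `V` if `char(k(x)) = 0`, or
`char(k(x)) ≥ dim(X)/2 + 1`»):

* characteristic `p > 0`: T7/T7b's route verbatim — `directrixSpace_le_prime_of_facts` fed with
  `Hironaka1970_thm1_cor_holds` (F-52, PROVED) and `mizutani1973_vectorGroup_of_dim_le_of_hironaka` (F-50b, PROVED by the
  pub-rosobs Mizutani enclosure from F-52), the dimension hypothesis `ē(C_{X,D,x}) + 2 ≤ 2p` coming from the PRINTED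
  hypothesis `dim X + 2 ≤ 2·char k(x)` (`CharHypothesis`) through `ē(C_{X,D,x}) ≤ ē_x(X) ≤ dim 𝒪_{X,x} ≤ dim X`
  (`geomDirDim_le_ringKrullDim`, `ringKrullDim_stalk_le_topologicalKrullDim`);
* characteristic `0`: NEW Literature lemma `HironakaScheme.directrixSpace_le_prime_of_charZero` (res-D-lib-1 p519965):
  `U(𝔭_{x'})` is generated by LINEAR forms (Hasse–Schmidt structure theorem at exponential characteristic `1`), so
  `𝒯(J_D) ⊆ 𝔭_{x'}` with no dimension hypothesis;
* both branches then conclude as T7b: `𝔭_{x'}` misses a variable ⇒ `e(C_{X,D,x}) ≥ 1`, and the (discharged)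
  Hironaka–Grothendieck isomorphism gives `e_x(X) ≥ e(C_{X,D,x}) + dim 𝒪_{D,x} > dim 𝒪_{D,x}`.

Consequences: `theorem314_geomDir_of_thmIV' : Hironaka1970_thmIV → Moving.Theorem314_geomDir` — the general-centre
numerical binder of the β row from F-51′ ALONE. [OURS · L1 W4.2] new-combination (the statement
`CossartJannsenSaito2020_thm_3_14` is CJS's, the implication is theirs too; the kernel assembly is ours); NOT a statement
of H. Hironaka's 2017 manuscript. AI-written (res-D-lib-1 g5); AI review is weaker than expert review.
-/

set_option linter.dupNamespace false

noncomputable section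

open CategoryTheory AlgebraicGeometry TopologicalSpace IsLocalRing MvPolynomial
open Literature.AlgebraicGeometry.Resolution Literature.AlgebraicGeometry.Resolution.HironakaScheme
open Literature.RingTheory.HilbertSamuel Literature.RingTheory.MvPolynomial
open Literature.AlgebraicGeometry.CossartJannsenSaito2020
open Summit.ResolutionOfSingularities.KangarooAtlas.Mizutani

namespace Summit.ResolutionOfSingularities.ResolutionOfSingularities.Theorems.SigmaMaxModificationsCorridor3.Directrix214Sharp

universe u

/-- **[OURS · L1 W4.2] CJS Thm. 3.14 (numerical form, as typed: `x'` near to `x ∈ D`, `D` permissible,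
`char k(x) = 0 ∨ dim X + 2 ≤ 2·char k(x)` ⇒ `dim 𝒪_{D,x} < e_x(X)`) from [H4] THEOREM IV alone** — the printed proof
(CJS p. 52) with every other input a tree theorem: [H5] Th. 1 Cor. (`Hironaka1970_thm1_cor_holds`), Mizutani
(`mizutani1973_vectorGroup_of_dim_le_of_hironaka _ (Hironaka1970_thm1_cor_holds _)`), the Hironaka–Grothendieck isomorphism
(`HerrmannIkedaOrbanz1988_cor_21_11_holds`), and in characteristic `0` the linear structure of `U(𝔭)`
(`directrixSpace_le_prime_of_charZero`). [OURS · L1 W4.2] new-combination; AI-written, weaker than expert review.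
[cite: CossartJannsenSaito2020, Thm. 3.14 and its proof p. 51–52] -/
theorem cjs_thm_3_14_of_thmIV (h51 : Hironaka1970_thmIV.{u}) : CossartJannsenSaito2020_thm_3_14.{u} := by
  intro X X' _ π D hexc hperm hπ N hdim x' hxD hCH hnear
  classical
  set A := X.presheaf.stalk (π.base x') with hA
  set K := ResidueField A with hK
  set B := X'.presheaf.stalk x' with hB
  set φ : A →+* B := (π.stalkMap x').hom with hφ
  haveI : IsLocalHom φ := π.toLRSHom.prop x'
  -- the permissible centre at `x`
  set I : Ideal A := stalkIdeal D (π.base x') with hI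
  have hIperm : I.IsPermissible := hperm _ hxD
  haveI hreg : IsRegularLocalRing (A ⧸ I) := hIperm.isRegularLocalRing
  -- the chart of the exceptional divisor at `x'`
  obtain ⟨t, ht, hspan⟩ := hπ.isEffectiveCartier.exists_stalkIdeal_eq_span x'
  have hmap : I.map φ = Ideal.span {t} := by
    rw [← hspan, stalkIdeal_comap_eq_map_stalkMap]
  -- minimal generators of `I`; `μ(I) ≥ 1` since `I` lies in no minimal prime
  obtain ⟨g₀, hg₀⟩ := exists_fun_span_eq_of_fg (I := I) (IsNoetherian.noetherian I)
  have hmpos : 0 < I.spanFinrank := by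
    by_contra h0
    have h0' : I.spanFinrank = 0 := by omega
    have hIbot : I = ⊥ := by
      rw [← hg₀, Ideal.span_eq_bot]
      rintro _ ⟨i, rfl⟩
      exact Fin.elim0 (Fin.cast h0' i)
    obtain ⟨q, hq, -⟩ := Ideal.exists_minimalPrimes_le (I := (⊥ : Ideal A)) (J := maximalIdeal A) bot_le
    exact hIperm.not_le_of_mem_minimalPrimes hq (hIbot ▸ bot_le)
  obtain ⟨n, hn⟩ : ∃ n, I.spanFinrank = n + 1 := ⟨_, (Nat.succ_pred_eq_of_pos hmpos).symm⟩
  set g : Fin (n + 1) → A := g₀ ∘ Fin.cast hn.symm with hg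
  have hgI : Ideal.span (Set.range g) = I := by
    have hsurj : Function.Surjective (Fin.cast hn.symm) := fun i => ⟨Fin.cast hn i, by simp⟩
    rw [hg, hsurj.range_comp]
    exact hg₀
  have hm : (Ideal.span (Set.range g)).spanFinrank = n + 1 := by rw [hgI, hn]
  -- `π^♯(g_i) = u_i t`
  have hu : ∀ i, ∃ ui : B, φ (g i) = ui * t := by
    intro i
    have hmem : φ (g i) ∈ I.map φ := by
      refine Ideal.mem_map_of_mem φ ?_
      rw [← hgI]
      exact Ideal.subset_span ⟨i, rfl⟩
    rw [hmap, Ideal.mem_span_singleton'] at hmem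
    obtain ⟨ui, hui⟩ := hmem
    exact ⟨ui, hui.symm⟩
  choose u hu using hu
  -- a lift `y` of a regular system of parameters of `A ⧸ I`
  set s := (maximalIdeal (A ⧸ I)).spanFinrank with hs
  have hdimI : ringKrullDim (A ⧸ I) = (s : WithBot ℕ∞) := hreg.spanFinrank_maximalIdeal.symm
  obtain ⟨ybar, hybar⟩ := exists_span_range_eq_maximalIdeal (A ⧸ I) (e := s) le_rfl
  have hy' : ∀ i, ∃ yi : A, Ideal.Quotient.mk I yi = ybar i := fun i => Ideal.Quotient.mk_surjective (ybar i)
  choose y hy using hy'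
  have hz : Ideal.span (Set.range (Fin.append g y)) = maximalIdeal A := by
    have hcomap : (maximalIdeal (A ⧸ I)).comap (Ideal.Quotient.mk I) = maximalIdeal A :=
      IsLocalRing.eq_maximalIdeal
        (Ideal.comap_isMaximal_of_surjective _ Ideal.Quotient.mk_surjective)
    have hybar' : Ideal.span (Set.range ybar) = (Ideal.span (Set.range y)).map (Ideal.Quotient.mk I) := by
      have hfun : ybar = (Ideal.Quotient.mk I) ∘ y := funext fun i => (hy i).symm
      rw [Ideal.map_span, ← Set.range_comp, hfun]
    rw [range_fin_append, Ideal.span_union, hgI, ← hcomap, ← hybar, hybar',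
      Ideal.comap_map_of_surjective _ Ideal.Quotient.mk_surjective]
    rw [sup_comm]
    congr 1
    exact (Ideal.mk_ker (I := I)).symm
  -- Hironaka–Grothendieck (F-split, PROVED): `J_z = J_D · k[Z]`
  have hJz := HerrmannIkedaOrbanz1988_cor_21_11_holds A I (n + 1) s g y hz hgI hreg hIperm.isNormallyFlat hdimI
  -- hence `z` is a minimal system of generators of `𝔪`
  have hE : (maximalIdeal A).spanFinrank = (n + 1) + s :=
    spanFinrank_maximalIdeal_eq_of_tangentConeIdeal_eq hm hz hJz
  -- F-51′: `J_D` is generated inside `U(𝔭_{x'})`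
  set JD := normalConeIdeal g with hJD
  set 𝔭 := Literature.RingTheory.HilbertSamuel.chartPrime φ u with h𝔭
  have h51' : JD ≤ Ideal.span ((JD : Set (MvPolynomial (Fin (n + 1)) K)) ∩
      (multAlgebra K 𝔭 : Set (MvPolynomial (Fin (n + 1)) K))) :=
    h51 X X' π D N x' (π.base x') hexc hperm hπ hdim rfl hxD hnear (n + 1) g t u hgI hn ht hmap hu
  -- `𝔭_{x'}` is a point of `ℙ(N_{D,x})`
  haveI : 𝔭.IsPrime := isPrime_chartPrime φ u
  obtain ⟨i₀, hi₀⟩ := exists_X_not_mem_chartPrime_of_map_eq φ hgI ht hmap hu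
  have hpt : IsPoint K 𝔭 := by
    refine ⟨isPrime_chartPrime φ u, fun f hf d => homogeneousComponent_mem_chartPrime φ u hf d, ?_⟩
    intro hle
    exact hi₀ (hle (by simp [irrelevant]))
  -- the core, by characteristic: `𝒯(J_D) ⊆ 𝔭_{x'}`
  have hcore : ∀ L ∈ directrixSpace JD, L ∈ 𝔭 := by
    by_cases hc0 : ringChar K = 0
    · -- characteristic `0`: `U(𝔭)` is generated by linear forms
      haveI : CharP K 0 := ringChar.eq_iff.mp hc0
      haveI : CharZero K := CharP.charP_to_charZero K
      exact fun L hL => directrixSpace_le_prime_of_charZero h51' hL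
    · -- characteristic `p`: Mizutani's bound from `dim X + 2 ≤ 2p`
      obtain ⟨d, hd, hor⟩ := hCH
      have hdp : d + 2 ≤ 2 * ringChar K := hor.resolve_left hc0
      set p := ringChar K with hp
      haveI : CharP K p := ringChar.charP K
      haveI hpp : Fact p.Prime := ⟨CharP.char_prime_of_ne_zero K hc0⟩
      -- `ē_x(X) ≤ dim 𝒪_{X,x} ≤ dim X = d`
      have hgeomle : Scheme.geomDirDim X (π.base x') ≤ d := by
        have h1 : (Scheme.geomDirDim X (π.base x') : WithBot ℕ∞) ≤ ringKrullDim A :=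
          Literature.RingTheory.HilbertSamuel.geomDirDim_le_ringKrullDim A
        have h2 : ringKrullDim A ≤ (d : WithBot ℕ∞) :=
          (ringKrullDim_stalk_le_topologicalKrullDim X (π.base x')).trans hd.le
        exact_mod_cast h1.trans h2
      set Kbar := AlgebraicClosure K with hKbar
      haveI : PerfectRing Kbar p := PerfectField.toPerfectRing p
      have hgeomA : Scheme.geomDirDim X (π.base x') = directrixDim ((tangentConeIdeal (Fin.append g y) hz).map
          (MvPolynomial.map (algebraMap K Kbar))) :=
        dirDimOver_eq' A Kbar hE (Fin.append g y) hz
      have hdir : directrixDim (JD.map (MvPolynomial.map (algebraMap K Kbar))) + 2 ≤ 2 * p := by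
        have h1 := directrixDim_add_le_directrixDim_map_rename s (JD.map (MvPolynomial.map (algebraMap K Kbar)))
        rw [← map_map_rename_eq, ← hJz, ← hgeomA] at h1
        calc directrixDim (JD.map (MvPolynomial.map (algebraMap K Kbar))) + 2
            ≤ Scheme.geomDirDim X (π.base x') + 2 := by omega
          _ ≤ d + 2 := by omega
          _ ≤ 2 * p := hdp
      exact fun L hL => directrixSpace_le_prime_of_facts p Kbar (Hironaka1970_thm1_cor_holds p)
        (mizutani1973_vectorGroup_of_dim_le_of_hironaka p (Hironaka1970_thm1_cor_holds p)) hpt h51' hdir hL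
  -- `𝔭_{x'}` misses `X_{i₀}`, so `e(C_{X,D,x}) ≥ 1`
  have hone : 1 ≤ directrixDim JD :=
    one_le_directrixDim_of_not_mem ((mem_homogeneousSubmodule 1 _).mpr (isHomogeneous_X K i₀))
      fun h => hi₀ (hcore _ h)
  -- `e_x(X) = e(J_z) ≥ e(J_D) + s ≥ 1 + s`
  have hdirDim : Scheme.dirDim X (π.base x') = directrixDim (tangentConeIdeal (Fin.append g y) hz) :=
    dirDim_eq' A hE (Fin.append g y) hz
  have hes : s + 1 ≤ Scheme.dirDim X (π.base x') := by
    have h1 := directrixDim_add_le_directrixDim_map_rename s JD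
    rw [← hJz, ← hdirDim] at h1
    omega
  have hlt : s < Scheme.dirDim X (π.base x') := by omega
  show ringKrullDim (A ⧸ I) < (Scheme.dirDim X (π.base x') : WithBot ℕ∞)
  rw [hdimI]
  exact_mod_cast hlt

/-- **The general-centre numerical binder of the β row from [H4] THEOREM IV ALONE**:
`Moving.Theorem314_geomDir` by T7b's `theorem314_geomDir_of_thmIV` with F-split supplied by
`HerrmannIkedaOrbanz1988_cor_21_11_holds` and CJS Thm. 3.14 by `cjs_thm_3_14_of_thmIV`. [OURS · L1 W4.2; AI-written]
[cite: CossartJannsenSaito2020, Thm. 3.14] -/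
theorem theorem314_geomDir_of_thmIV' (h51 : Hironaka1970_thmIV.{u}) : Moving.Theorem314_geomDir.{u} :=
  theorem314_geomDir_of_thmIV h51 HerrmannIkedaOrbanz1988_cor_21_11_holds (cjs_thm_3_14_of_thmIV h51)

end Summit.ResolutionOfSingularities.ResolutionOfSingularities.Theorems.SigmaMaxModificationsCorridor3.Directrix214Sharp

end
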